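import Mathlib
import HarnessLib
import Summits.HubbardSuperconductivity.HubbardSuperconductivity.Theorems.KLProgrammeKLRegimeEngineFrameShiftDressingSupFlowTablesGN
import Summits.HubbardSuperconductivity.HubbardSuperconductivity.Theorems.KLProgrammeKLRegimeEngineGeneralStepAliasRowsGraded

/-!
# K3 gen-8-FLOW (stmt 20437, stub (C), «(C)-B-ALIAS-L», located «(C)-S-ROW-GRADING»): THE GENERAL-STEP (B) DOOR WITH ITS ALIAS GROUPS DISCHARGED AT
# `Md = 38` AND GRADED FAR ENVELOPES — `norm_iteratedFDeriv_klLocSelfEnergyRe_flowFrame_sub_le_main_add_alias_graded` (cell gate-hubbard-kl, seat p2 g21)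

Twin of the general-step (B) door of record `…FrameShiftDressingSupFlowMainAlias.norm_iteratedFDeriv_klLocSelfEnergyRe_flowFrame_sub_le_main_add_alias` (p640117;
`Md = 28`, `10 ≤ s`, ungraded far envelopes).  WHY (KL STATUS 2026-08-28 15:26Z, located «(C)-S-ROW-GRADING»): the two-leg data of the door at scale `m` have
position kernels of range `Λ_m⁻¹ = 32·4^m`, so their lattice moments of order `k` are naturally `≍ (32·4^m)^k × (order-0 mass)`; at `Md = 28` the alias currency
`4^m·Nj²·√Rsq⁸U²⁰/(2^60β⁴)` is then not β-uniform at deep scales for `j ≥ 2`, and no β-uniform far envelope `Ns ≥ |β|L²·Ss` exists.  HERE the upstream door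
`…SupFlowTablesGN.…_aliasing_gevrey_numeral4` (p593193, `Md`-parametric) is called at `Md := 38` (TEN more spent derivatives, each worth `U/(2^26β)`) with the
closed envelopes `(Ξ, Θ, Φ := 1)` of `…FlowEnvelopeChoice` (ONE `U`-door `1/128`), and the alias groups are bounded by `…GeneralStepAliasRowsGraded.generalAliasGroups38_le`:
`‖Dʲ(symbol difference)(q)‖ ≤ MAIN + (2^29·4^m·Nj² + 2^12 + 2^23·Nj′)·(√Rsq⁸U³⁰/(2^218β^14)) + (2^26·4^m·Ns² + 2^9 + 2^20·Ns′)·Xv⁴`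
(`Xv = U/(2^59·klEngPsq P²·klEngRsq R²·β³)`), MAIN = the upstream door's frame-distance × tower term VERBATIM (at `Md = 38`).  Inputs: as p640117 except
`hs : 30 ≤ s` and the GRADED far envelopes `|β|·L²·Ss ≤ Ns·((4:ℝ)^m)^s`, `Ss′ ≤ Ns′·((4:ℝ)^m)^s`; the per-order alias envelopes `|β|·L²·Sj ≤ Nj`, `Sj′ ≤ Nj′` as before
(the natural `Nj ≍ N₀·(32·4^m)ʲ` is absorbed by the new currency: `4^{9m}/β^{14} ≤ β^{−5}`).

* **`norm_iteratedFDeriv_klLocSelfEnergyRe_flowFrame_sub_le_main_add_alias_graded`**.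

Composition only; no definitions; nothing asserts superconductivity.  References: BGM 2006 §2.3 (2.21)–(2.24) [cite: BenfattoGiulianiMastropietro2006];
Salmhofer 1999 §4.2.5; Disertori–Rivasseau 2000 §II.2.
-/

noncomputable section

namespace Summit.HubbardSuperconductivity.HubbardSuperconductivity.Theorems.EngineV8

set_option linter.dupNamespace false -- summit = problem name (single-conjunct summit), D-0017

open Real Finset Filter Literature.MathematicalPhysics.QuantumLattice Literature.Probability.LatticeModels GrassmannAlgebra
open Summit.HubbardSuperconductivity.HubbardSuperconductivity.Theorems.KLRegimeSplit
open Summit.HubbardSuperconductivity.HubbardSuperconductivity.Theorems.DispersionFlow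
open Summit.HubbardSuperconductivity.HubbardSuperconductivity.Theorems.KLProgrammeLegKernels
open scoped Nat

variable {L M : ℕ} [NeZero L] [NeZero M]

section MainAliasGraded

/-- **THE GENERAL-STEP (B) DOOR AT `Md = 38` WITH THE ALIAS GROUPS DISCHARGED AND GRADED FAR ENVELOPES** — see the module docstring. [cite: BenfattoGiulianiMastropietro2006, §2.3 (2.21)–(2.24)] -/
theorem norm_iteratedFDeriv_klLocSelfEnergyRe_flowFrame_sub_le_main_add_alias_graded {β : ℝ} (hβmin : klBetaMin ≤ β) {U : ℝ} (hU : 0 < U) (hU1 : U ≤ 1) (μ : ℝ) (m : ℕ)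
    {G : GeoConsts} {Q : EngConsts} {R : RenConsts} (hRG : ∀ j, 0 ≤ R.Gfr j) (hGS : ∀ k, 0 ≤ G.S k) (hQS : ∀ k, 0 ≤ Q.S' k) (hμ : μ ∈ klWindowC)
    {Nf₁ Nf₂ : ℕ} (hOK₁ : FrameOK R U Nf₁ μ (klFlowFrameU L M β U μ m)) (hOK₂ : FrameOK R U Nf₂ μ (klFlowFrameU L M β U μ (m + 1)))
    {fd : ℝ} (hfdist : frameDist (klFlowFrameU L M β U μ (m + 1)) (klFlowFrameU L M β U μ m) ≤ fd) (hfd : fd ≤ (klScale klE0 m) / 4)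
    (hZ₂ : IsUnit (effPartitionFn ℂ (normalCovariance L M (uvSymbolCT L M β μ (klFlowFrameU L M β U μ (m + 1)) (klScale klE0 m))) (hubbardInteraction L M β U + counterQuadratic L M β (klFlowFrameU L M β U μ (m + 1)))))
    (hZ : ∀ t ∈ Set.Icc (0 : ℝ) 1, effPartitionFn ℂ
      (normalCovariance L M (uvSymbolCT L M β μ (klFlowFrameU L M β U μ m) (klScale klE0 m)) + ((t : ℂ)) • (normalCovariance L M (fun ks => uvSymbolCT L M β μ (klFlowFrameU L M β U μ (m + 1)) (klScale klE0 m) ks / (1 + uvSymbolCT L M β μ (klFlowFrameU L M β U μ (m + 1)) (klScale klE0 m) ks * (((fsub (klFlowFrameU L M β U μ (m + 1)) (klFlowFrameU L M β U μ m)).eval (latticeMomentum L ks.1.2) / (β * (L : ℝ) ^ 2) : ℝ) : ℂ))) - normalCovariance L M (uvSymbolCT L M β μ (klFlowFrameU L M β U μ m) (klScale klE0 m)))) (hubbardInteraction L M β U + counterQuadratic L M β (klFlowFrameU L M β U μ m)) ≠ 0)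
    (j : ℕ) (q : Momentum) {N : ℝ} (hN0 : 0 ≤ N)
    (hN : ∀ t ∈ Set.Icc (0 : ℝ) 1, ∀ i ∈ ({omega0 M, (omega0 M).rev} : Finset (MatsubaraIdx M)), ∀ σ : Fin 2, ∀ Al : HubbardFieldIdx L M,
      |matsubaraFreq β M Al.1.1.1| < (klScale klE0 m) →
      (|nambuXiCT L μ (klFlowFrameU L M β U μ m) Al.1.1.2| < (klScale klE0 m) ∨ |nambuXiCT L μ (klFlowFrameU L M β U μ (m + 1)) Al.1.1.2| < (klScale klE0 m)) →
      ∑ x : TorusSite 2 L, (1 + ((x 0).valMinAbs.natAbs : ℝ) + ((x 1).valMinAbs.natAbs : ℝ)) ^ j * ‖torusFourierInv (fun kv : TorusSite 2 L =>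
        kernel ℂ (effAction ℂ (normalCovariance L M (uvSymbolCT L M β μ (klFlowFrameU L M β U μ m) (klScale klE0 m)) + ((t : ℂ)) • (normalCovariance L M (fun ks => uvSymbolCT L M β μ (klFlowFrameU L M β U μ (m + 1)) (klScale klE0 m) ks / (1 + uvSymbolCT L M β μ (klFlowFrameU L M β U μ (m + 1)) (klScale klE0 m) ks * (((fsub (klFlowFrameU L M β U μ (m + 1)) (klFlowFrameU L M β U μ m)).eval (latticeMomentum L ks.1.2) / (β * (L : ℝ) ^ 2) : ℝ) : ℂ))) - normalCovariance L M (uvSymbolCT L M β μ (klFlowFrameU L M β U μ m) (klScale klE0 m)))) (hubbardInteraction L M β U + counterQuadratic L M β (klFlowFrameU L M β U μ m))) 4 (Fin.snoc (Fin.snoc ![((((i, kv), σ), 0) : HubbardFieldIdx L M), (((i, kv), σ), 1)] (Al.1, 1 - Al.2) : Fin 3 → HubbardFieldIdx L M) Al)) x‖ ≤ N)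
    (hq₂ : (Real.pi / β) ^ 2 + frameLevel μ (klFlowFrameU L M β U μ (m + 1)) q ^ 2 < (klScale klE0 m) ^ 2 / 4) (hq₁ : (Real.pi / β) ^ 2 + frameLevel μ (klFlowFrameU L M β U μ m) q ^ 2 < (klScale klE0 m) ^ 2 / 4)
    {s : ℕ} (hs : 30 ≤ s) (hj : j ≤ 4) {Sj Ss Sj' Ss' Nj Ns Nj' Ns' : ℝ}
    (hRmom : ∀ t ∈ Set.Icc (0 : ℝ) 1, ∀ i ∈ ({omega0 M, (omega0 M).rev} : Finset (MatsubaraIdx M)), ∀ σ : Fin 2,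
      (∑ x : TorusSite 2 L, (1 + ((x 0).valMinAbs.natAbs : ℝ) + ((x 1).valMinAbs.natAbs : ℝ)) ^ j * ‖torusFourierInv (fun kv : TorusSite 2 L =>
        kernel ℂ (effAction ℂ (normalCovariance L M (uvSymbolCT L M β μ (klFlowFrameU L M β U μ m) (klScale klE0 m)) + ((t : ℂ)) • (normalCovariance L M (fun ks => uvSymbolCT L M β μ (klFlowFrameU L M β U μ (m + 1)) (klScale klE0 m) ks / (1 + uvSymbolCT L M β μ (klFlowFrameU L M β U μ (m + 1)) (klScale klE0 m) ks * (((fsub (klFlowFrameU L M β U μ (m + 1)) (klFlowFrameU L M β U μ m)).eval (latticeMomentum L ks.1.2) / (β * (L : ℝ) ^ 2) : ℝ) : ℂ))) - normalCovariance L M (uvSymbolCT L M β μ (klFlowFrameU L M β U μ m) (klScale klE0 m)))) (hubbardInteraction L M β U + counterQuadratic L M β (klFlowFrameU L M β U μ m))) 2 ![((((i, kv), σ), 0) : HubbardFieldIdx L M), (((i, kv), σ), 1)]) x‖ ≤ Sj) ∧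
      (∑ x : TorusSite 2 L, (1 + ((x 0).valMinAbs.natAbs : ℝ) + ((x 1).valMinAbs.natAbs : ℝ)) ^ s * ‖torusFourierInv (fun kv : TorusSite 2 L =>
        kernel ℂ (effAction ℂ (normalCovariance L M (uvSymbolCT L M β μ (klFlowFrameU L M β U μ m) (klScale klE0 m)) + ((t : ℂ)) • (normalCovariance L M (fun ks => uvSymbolCT L M β μ (klFlowFrameU L M β U μ (m + 1)) (klScale klE0 m) ks / (1 + uvSymbolCT L M β μ (klFlowFrameU L M β U μ (m + 1)) (klScale klE0 m) ks * (((fsub (klFlowFrameU L M β U μ (m + 1)) (klFlowFrameU L M β U μ m)).eval (latticeMomentum L ks.1.2) / (β * (L : ℝ) ^ 2) : ℝ) : ℂ))) - normalCovariance L M (uvSymbolCT L M β μ (klFlowFrameU L M β U μ m) (klScale klE0 m)))) (hubbardInteraction L M β U + counterQuadratic L M β (klFlowFrameU L M β U μ m))) 2 ![((((i, kv), σ), 0) : HubbardFieldIdx L M), (((i, kv), σ), 1)]) x‖ ≤ Ss))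
    (hSE : ∀ i ∈ ({omega0 M, (omega0 M).rev} : Finset (MatsubaraIdx M)), ∀ σ : Fin 2,
      (∑ x : TorusSite 2 L, (1 + ((x 0).valMinAbs.natAbs : ℝ) + ((x 1).valMinAbs.natAbs : ℝ)) ^ j * ‖torusFourierInv (fun kv : TorusSite 2 L =>
        selfEnergy L M β (effAction ℂ (normalCovariance L M (fun ks => uvSymbolCT L M β μ (klFlowFrameU L M β U μ (m + 1)) (klScale klE0 m) ks / (1 + uvSymbolCT L M β μ (klFlowFrameU L M β U μ (m + 1)) (klScale klE0 m) ks * (((fsub (klFlowFrameU L M β U μ (m + 1)) (klFlowFrameU L M β U μ m)).eval (latticeMomentum L ks.1.2) / (β * (L : ℝ) ^ 2) : ℝ) : ℂ)))) (hubbardInteraction L M β U + counterQuadratic L M β (klFlowFrameU L M β U μ m))) (i, kv) σ) x‖ ≤ Sj') ∧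
      (∑ x : TorusSite 2 L, (1 + ((x 0).valMinAbs.natAbs : ℝ) + ((x 1).valMinAbs.natAbs : ℝ)) ^ s * ‖torusFourierInv (fun kv : TorusSite 2 L =>
        selfEnergy L M β (effAction ℂ (normalCovariance L M (fun ks => uvSymbolCT L M β μ (klFlowFrameU L M β U μ (m + 1)) (klScale klE0 m) ks / (1 + uvSymbolCT L M β μ (klFlowFrameU L M β U μ (m + 1)) (klScale klE0 m) ks * (((fsub (klFlowFrameU L M β U μ (m + 1)) (klFlowFrameU L M β U μ m)).eval (latticeMomentum L ks.1.2) / (β * (L : ℝ) ^ 2) : ℝ) : ℂ)))) (hubbardInteraction L M β U + counterQuadratic L M β (klFlowFrameU L M β U μ m))) (i, kv) σ) x‖ ≤ Ss'))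
    -- the flow history and the envelope parameters (the cutoff tables are now numerals)
    {n : ℕ} (hP : ∀ m' ≤ n, FlowPieceJetsAt L M β U μ R m') (hTJ : ∀ m' ≤ n, TwoLegReadJetsF L M G Q β U μ m') (hmn : m ≤ n)
    (hR0 : 0 < R.Gfr 0) {W Ξ Θ : ℝ} (hW : W = curveExtC (8 * 576 * (342 : ℝ) ^ 4) G.S 1 + curveExtC (8 * 576 * (342 : ℝ) ^ 4) Q.S' 1 * |U|)
    (hΞ : Ξ = (2 ^ 10 * (1 + Real.pi ^ 8 * (W * U ^ 2) / 2 ^ 11) + ∑ j ∈ range 5, R.Gfr j))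
    (hΘ : Θ = (1 + ((∑ j ∈ range 5, R.Gfr j) + Real.pi ^ 8 * W / 2 ^ 11) * |U| / R.Gfr 0))
    (hdoor : R.Gfr 0 * |U| + ((∑ j ∈ range 5, R.Gfr j) + Real.pi ^ 8 * W / 2 ^ 11) * U ^ 2 ≤ 1 / 128) {P : SplitConsts} (hL : klEngL₄ P R β U ≤ L) (hmβ : m ≤ nScales β + 1)
    (hNj : |β| * (L : ℝ) ^ 2 * Sj ≤ Nj) (hNs : |β| * (L : ℝ) ^ 2 * Ss ≤ Ns * ((4 : ℝ) ^ m) ^ s) (hNj' : Sj' ≤ Nj') (hNs' : Ss' ≤ Ns' * ((4 : ℝ) ^ m) ^ s) :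
    ‖iteratedFDeriv ℝ j (evalM (symInterp L (fun kv : TorusSite 2 L =>
        klLocSelfEnergyRe L M β U μ (klFlowFrameU L M β U μ (m + 1)) m kv - klLocSelfEnergyRe L M β U μ (klFlowFrameU L M β U μ m) m kv - (fsub (klFlowFrameU L M β U μ (m + 1)) (klFlowFrameU L M β U μ m)).eval (latticeMomentum L kv)))) q‖ ≤
      2 * (2 * (|β| * (L : ℝ) ^ 2) * (12 * (2 * ((klScale klE0 m) * β / Real.pi + 3) * ((1793 * (klScale klE0 m) * (L : ℝ) ^ 2 + 704 * L) + (1793 * (klScale klE0 m) * (L : ℝ) ^ 2 + 704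
        * L)) * (β * (L : ℝ) ^ 2 * (200 + 200 * 4) / (klScale klE0 m) ^ 2 * fd)) * N)) +
      ((2 ^ 29 * (4 : ℝ) ^ m * Nj ^ 2 + 2 ^ 12 + 2 ^ 23 * Nj') * (Real.sqrt (klEngRsq R) ^ 8 * U ^ 30 / (2 ^ 218 * β ^ 14)) + (2 ^ 26 * (4 : ℝ) ^ m * Ns ^ 2 + 2 ^ 9 + 2 ^ 20 * Ns') * (U
        / (2 ^ 59 * klEngPsq P ^ 2 * klEngRsq R ^ 2 * β ^ 3)) ^ 4) := by
  have hβ0 : 0 < β := KLRegimeSplit.pos_of_klBetaMin_le hβmin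
  have hU1' : |U| ≤ 1 := by rw [abs_of_pos hU]; exact hU1
  have hX40 : (0 : ℝ) ≤ 8 * 576 * (342 : ℝ) ^ 4 := by norm_num
  have hWs0 : 0 ≤ curveExtC (8 * 576 * (342 : ℝ) ^ 4) G.S 1 + curveExtC (8 * 576 * (342 : ℝ) ^ 4) Q.S' 1 * |U| := by
    have h1 := curveExtC_nonneg hX40 hGS 1; have h2 := curveExtC_nonneg hX40 hQS 1; positivity
  have hW0 : 0 ≤ W := by rw [hW]; exact hWs0
  have hΞ0 : 0 ≤ Ξ := by rw [hΞ]; exact Xi_nonneg hRG hW0 U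
  have hΘ0 : 0 ≤ Θ := by rw [hΘ]; exact Theta_nonneg hRG hR0 hW0 U
  have hΞ' : ∀ i, 1 ≤ i → (if i ≤ 4 then R.Gfr i * uPow i U else 2 ^ i * (Real.pi ^ 8 / 4 * 2 ^ (i - 1) * (2 : ℝ) ^ (8 * (i - 1))) * ((curveExtC (8 * 576 * (342 : ℝ) ^ 4) G.S 1 + curveExtC (8 * 576 * (342 : ℝ) ^ 4) Q.S' 1 * |U|) * U ^ 2)) ≤ i ! * Ξ ^ i := by
    intro i hi; rw [hΞ, hW]; exact flowTableA_le_factorial_mul_pow hRG hWs0 hU1' hi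
  have hΘΦ : ∀ i : ℕ, (if i ≤ 4 then R.Gfr i * uPow i U else 2 ^ i * (Real.pi ^ 8 / 4 * 2 ^ (i - 1) * (2 : ℝ) ^ (8 * (i - 1))) * ((curveExtC (8 * 576 * (342 : ℝ) ^ 4) G.S 1 + curveExtC (8 * 576 * (342 : ℝ) ^ 4) Q.S' 1 * |U|) * U ^ 2)) ≤ R.Gfr 0 * |U| * Θ * i ! * (2 ^ 10 * (1 : ℝ)) ^ i := by
    intro i; rw [hΘ, hW]; exact flowTableA_le_mul_factorial_mul_pow hRG hR0 hWs0 U i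
  have hδΛ : R.Gfr 0 * |U| * Θ * ((16 : ℝ) ^ m)⁻¹ ≤ klScale klE0 m / 4 := by
    rw [hΘ]; exact Gfr_mul_Theta_inv_pow_le_klScale_div_four hR0 hdoor m
  -- the upstream door at `Md := 38`, `Φ := 1`
  have hmain := norm_iteratedFDeriv_klLocSelfEnergyRe_flowFrame_sub_le_aliasing_gevrey_numeral4 hβ0 U μ m hRG hGS hQS hμ hOK₁ hOK₂ hfdist hfd hZ₂ hZ j q hN0 hN
    hq₂ hq₁ (show 4 + j ≤ 38 by omega) hRmom hSE hP hTJ hmn hΞ0 hΘ0 zero_le_one hΞ' hΘΦ hδΛ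
  -- the moments are nonnegative
  have hmem0 : (0 : ℝ) ∈ Set.Icc (0 : ℝ) 1 := ⟨le_rfl, zero_le_one⟩
  have hmemi : omega0 M ∈ ({omega0 M, (omega0 M).rev} : Finset (MatsubaraIdx M)) := by simp
  obtain ⟨hm1, hm2⟩ := hRmom 0 hmem0 (omega0 M) hmemi 0
  obtain ⟨hm3, hm4⟩ := hSE (omega0 M) hmemi 0
  have hSj0 : 0 ≤ Sj := le_trans (Finset.sum_nonneg fun x _ => by positivity) hm1
  have hSs0 : 0 ≤ Ss := le_trans (Finset.sum_nonneg fun x _ => by positivity) hm2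
  have hSj'0 : 0 ≤ Sj' := le_trans (Finset.sum_nonneg fun x _ => by positivity) hm3
  have hSs'0 : 0 ≤ Ss' := le_trans (Finset.sum_nonneg fun x _ => by positivity) hm4
  have halias := generalAliasGroups38_le (L := L) hRG hR0 hW0 hβmin hU hU1 hΞ hΘ hdoor hL hmβ hs hj hSj0 hSs0 hSj'0 hSs'0 hNj hNs hNj' hNs'
  exact hmain.trans ((add_assoc _ _ _).le.trans (add_le_add le_rfl halias))

end MainAliasGraded

end Summit.HubbardSuperconductivity.HubbardSuperconductivity.Theorems.EngineV8

end
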